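import Summits.BirchSwinnertonDyer.Rank1Residual.Additive.TypeGThreeTowerOfSurj
import HarnessLib

/-!
# The N11 CORNER THEOREM at `p = 3`, v3 — EXOTIC input on the `e ≠ 2` rows ONLY (the tower is a
# theorem on every type-(G) row at `3` since Wuthrich's Lemma 20 became a theorem): the `p = 3`
# restriction of `x4SharpUnitFree_iff_lower_and_residues_sharp_exoticTypeG_noL20` PER PAIR
# (cell `b2b-bsdres`, team n1011, seat p16, sub-target T-b2c v3; base named by n1011-p14 GEN 2)

HONEST FRAMING (cell `b2b-bsdres`, run/shared/lean/b2b/bsd-rank1-residual/, verbatim in every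
file): the goal of the cell is to DELETE the COMBINATION-SHAPED residual classes of the
Birch–Swinnerton-Dyer formula for ALL analytic-rank `≤ 1` elliptic curves over `ℚ` — "full BSD
formula for every rank `≤ 1` curve in class `C`" assembled STRICTLY from published theorems — so
that the rank-`≤ 1` remainder becomes exactly the CONSTRUCTION-SHAPED classes, which are TYPED
(missing-input `Prop`s), NOT attempted. This is not "finishing BSD". Team n1011 (N10 / N11):
research route; prove what is provable now; no claim beyond the stated classes; X4 stays
CONSTRUCTION-SHAPED; the N11 mark is UNCHANGED by this file; nothing is booked. Theorems only (no
definition, no named fact minted; every published input is an explicit named-fact hypothesis).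

## What and why

Third sibling of `Additive/X4SharpThreeCorner.lean` (p250028) / `…NoLemma20.lean` (p250846). With
Wuthrich 2014 Lemma 20 a THEOREM of the tree in ALL its cases (lit-kato / n1011-p02;
`Wuthrich2014.lemma20_surjective_threeAdic_of_semistable_holds`), n1011-p14's
`TypeG.towerSurj_three_of_surj` (`TypeGThreeTowerOfSurj`, p251574) gives the `3`-adic tower from
surj(3) on EVERY type-(G) row at `3` — Kodaira `I₀*`, whether the good twist is ordinary OR
SUPERSINGULAR — and the end-state of record becomes
`x4SharpUnitFree_iff_lower_and_residues_sharp_exoticTypeG_noL20`: the EXOTIC residue is quantified over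
the rows with `¬ TypeG W 3` only (potentially good with NO semistable quadratic twist: Kodaira
II/III/IV/IV*/III*/II* at `3`). This file restates the eight per-pair / non-residue / class-level
corner theorems accordingly (names `…_typeG`, `x4SharpThreeUnitFree_iff_lower_and_residues_exoticTypeG`):
the EXOTIC input is asked only on `¬ TypeG W 3` rows, and on the NON-RESIDUE side `TypeG W 3` may
stand in for the tower certificate (the Gss ∣ `I₀*` cells of N11 need no certificate for the tower
any more; they still need defect `≤ 1`, even `ord₃ #Ш_an` and a Manin datum, or a residue input).
Binders = the end-state of record's eight (hCT hKatoS hDel hGZK hmod hmodD hKatoχ hK). Counts of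
record unchanged (RESIDUAL-MAP §I N11); N11 stays NEEDS; nothing booked.

References: Kato 2004 [Kato2004Asterisque] Thm. 14.5 (3) (p. 236), (12.5.2) (p. 222), Thm. 17.4 (3)
(p. 273); Delbourgo 1998 [Delbourgo1998] Prop. 4 (p. 144); Wuthrich 2014 [Wuthrich2014] Lemma 20
(p. 399), Thm. 3 (p. 383), Cor. 19 (p. 398); Cassels 1962 / Silverman *AEC* X.4.14 [SilvermanAEC2009];
Kim 2026 [Kim2022StructureSelmer] Conj. 1.10; Miller 2011 [Miller2011LMS] Def. 1.1.
-/

noncomputable section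

open scoped Classical

open WeierstrassCurve Literature.NumberTheory.EllipticCurves
  Literature.NumberTheory.EllipticCurves.ModularForms
  Literature.NumberTheory.EllipticCurves.Rank1Residual
  Literature.NumberTheory.EllipticCurves.Rank1Residual.Typed

namespace Summit.BirchSwinnertonDyer.Rank1Residual.Additive

variable (W : WeierstrassCurve ℚ) [W.IsElliptic] [W.IsGloballyMinimal]

/-! ### §1 One curve at `p = 3` (binders of record): the upper half from the facts and the four residue inputs -/

/-- **The N11 corner, per pair: UPPER half at `3` outside / modulo the four residue pieces.** Let
`W` be globally minimal with `r_an = 0`, `ClassX4 W 3` (additive at `3`, `E[3]` irreducible) and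
`ρ̄_{E,3}` onto. Granted the eight published inputs and, FOR THIS CURVE, the four residue inputs
(EXOTIC(¬(G)): pot. good, NOT of type (G) at `3` (`e ≠ 2`), tower fails ⟹ upper; TAM-DEFECT₂♭: `v₃(c₃) + 2 ≤ ord₃ ∏ c_ℓ`
⟹ upper; ODD-SHA♭: `ord₃ #Ш_an` odd ⟹ upper; MANIN♭: no datum with `3 ∤ c_D` ⟹ upper), the upper
half `MissingUpperBoundAt W 3` holds. Route: `ord₃ j < 0` ⟹ the (M)@3 chain with the
certificate-free tower (n1011-p14 `ClassX4M.missingUpperBoundAt_rankZero_of_surj_noL20`, general-`p` half-eigen reading);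
(G)-ordinary ⟹ defect `2` at `3` and additive-p2's `ω`-branch chain, Tamagawa- and Manin-free
(`ClassX4Gord.missingUpperBoundAt_three_of_katoComponent_of_surj`); otherwise tower ∧ datum ∧
defect `≤ 1` ∧ even ⟹ the sharp Kato bound + Cassels–Tate parity
(`X4RankZero.missingUpperBoundAt_of_katoSharp_of_casselsTate_of_tamDefect_le_one_of_even`), and
each failing bit is exactly one residue input. [cite: Kato2004Asterisque, Thm. 14.5 (3) (p. 236), Thm. 17.4 (3) (p. 273)]
[cite: Delbourgo1998, Prop. 4 (p. 144)] [cite: SilvermanAEC2009, Thm. X.4.14] [cite: Miller2011LMS, Def. 1.1] -/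
theorem X4RankZero.missingUpperBoundAt_three_of_residueInputs_typeG [Fact (Nat.Prime 3)]
    (hCT : exists_casselsTate_pairing (K := ℚ))
    (hKatoS : Kato2004.rankZero_padicValNat_sha_le_sub_localTamagawa_of_additive_potGood_of_imageContainsSL2)
    (hDel : Delbourgo1998.prop4_rankZero_pow_dvd_constantCoeff)
    (hGZK : rank_eq_analyticRank_of_analyticRank_le_one) (hmod : hasEntireLFunction_rat)
    (hmodD : nonempty_modularParametrizationData)
    (hKatoχ : Wuthrich2014.kato_halfEigenCharIdeal_dvd_cyclotomicPrime_of_surjective)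
    (hK : Kato2004.charIdeal_dvd_padicLFunctionBranch_component_of_surjective)
    (hr : W.analyticRank = 0) (hX : ClassX4 W 3) (hs : Surj W 3)
    (hexotic : 0 ≤ padicValRat 3 W.j → ¬ TypeG W 3 →
      ¬ (∀ n : ℕ, W.HasSurjectiveModNGaloisRep (3 ^ n : ℕ)) → MissingUpperBoundAt W 3)
    (htam : 0 ≤ padicValRat 3 W.j → ¬ (TypeGOrd W 3 ∧ semistabilityIndex W 3 = 2) →
      padicValNat 3 ((W.baseChange ℚ_[3]).localTamagawaNumber ℤ_[3]) + 2 ≤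
        padicValNat 3 W.tamagawaProduct → MissingUpperBoundAt W 3)
    (hodd : 0 ≤ padicValRat 3 W.j → ¬ (TypeGOrd W 3 ∧ semistabilityIndex W 3 = 2) →
      (∃ q : ℚ, shaAn W = (q : ℂ) ∧ Odd (padicValRat 3 q)) → MissingUpperBoundAt W 3)
    (hmanin : 0 ≤ padicValRat 3 W.j → ¬ (TypeGOrd W 3 ∧ semistabilityIndex W 3 = 2) →
      (∀ (N : ℕ) [NeZero N] (D : ModularParametrizationData W N), (3 : ℤ) ∣ D.maninConstant) →
      MissingUpperBoundAt W 3) :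
    MissingUpperBoundAt W 3 := by
  by_cases hj : padicValRat 3 W.j < 0
  · -- (M)@3: the multiplicative-twist chain, tower from surj(3) alone (n1011-p14)
    exact AdditivePotMult.ClassX4M.missingUpperBoundAt_rankZero_of_surj_noL20 hDel hGZK hmod hmodD
      hKatoχ ⟨hX, hX.2.1, hj⟩ hr hs
  · have hj' : 0 ≤ padicValRat 3 W.j := not_lt.mp hj
    by_cases hG : TypeGOrd W 3
    · -- (G-ord)@3 = (G-ord, e = 2)@3: the ω-branch chain, Tamagawa/Manin-free
      exact ClassX4Gord.missingUpperBoundAt_three_of_katoComponent_of_surj hK hDel hGZK hmod hmodD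
        ⟨hX, hG⟩ hr hs
    · have hnG : ¬ (TypeGOrd W 3 ∧ semistabilityIndex W 3 = 2) := fun h ↦ hG h.1
      by_cases htower : ∀ n : ℕ, W.HasSurjectiveModNGaloisRep (3 ^ n : ℕ)
      · by_cases hD : ∃ (N : ℕ) (_ : NeZero N) (D : ModularParametrizationData W N),
            ¬ (3 : ℤ) ∣ D.maninConstant
        · obtain ⟨N, hN, D, hc⟩ := hD
          haveI := hN
          obtain ⟨q, hq, -⟩ :=
            X4RankZero.padicValNat_shaOrder_le_of_katoSharp W 3 hKatoS hGZK hmod hr hX hj' htower D hc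
          by_cases h1 : padicValNat 3 W.tamagawaProduct ≤
              padicValNat 3 ((W.baseChange ℚ_[3]).localTamagawaNumber ℤ_[3]) + 1
          · rcases Int.even_or_odd (padicValRat 3 q) with heven | hqodd
            · exact X4RankZero.missingUpperBoundAt_of_katoSharp_of_casselsTate_of_tamDefect_le_one_of_even
                W 3 hCT hKatoS hGZK hmod hr hX hj' htower D hc h1 hq heven
            · exact hodd hj' hnG ⟨q, hq, hqodd⟩
          · exact htam hj' hnG (by omega)
        · refine hmanin hj' hnG fun N _ D ↦ ?_
          by_contra hc
          exact hD ⟨N, inferInstance, D, hc⟩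
      · exact hexotic hj' (fun hT ↦ htower (TypeG.towerSurj_three_of_surj hT hX.2.1 hs)) htower

/-- **Per pair at `3`, granted the residue inputs: the typed missing input is EXACTLY the LOWER
half** (`MissingPPartAt W 3 ↔ MissingLowerBoundAt W 3`). [cite: Kato2004Asterisque, Thm. 14.5 (3) (p. 236)]
[cite: Delbourgo1998, Prop. 4 (p. 144)] [cite: Miller2011LMS, Def. 1.1] -/
theorem X4RankZero.missingPPartAt_three_iff_lower_of_residueInputs_typeG [Fact (Nat.Prime 3)]
    (hCT : exists_casselsTate_pairing (K := ℚ))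
    (hKatoS : Kato2004.rankZero_padicValNat_sha_le_sub_localTamagawa_of_additive_potGood_of_imageContainsSL2)
    (hDel : Delbourgo1998.prop4_rankZero_pow_dvd_constantCoeff)
    (hGZK : rank_eq_analyticRank_of_analyticRank_le_one) (hmod : hasEntireLFunction_rat)
    (hmodD : nonempty_modularParametrizationData)
    (hKatoχ : Wuthrich2014.kato_halfEigenCharIdeal_dvd_cyclotomicPrime_of_surjective)
    (hK : Kato2004.charIdeal_dvd_padicLFunctionBranch_component_of_surjective)
    (hr : W.analyticRank = 0) (hX : ClassX4 W 3) (hs : Surj W 3)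
    (hexotic : 0 ≤ padicValRat 3 W.j → ¬ TypeG W 3 →
      ¬ (∀ n : ℕ, W.HasSurjectiveModNGaloisRep (3 ^ n : ℕ)) → MissingUpperBoundAt W 3)
    (htam : 0 ≤ padicValRat 3 W.j → ¬ (TypeGOrd W 3 ∧ semistabilityIndex W 3 = 2) →
      padicValNat 3 ((W.baseChange ℚ_[3]).localTamagawaNumber ℤ_[3]) + 2 ≤
        padicValNat 3 W.tamagawaProduct → MissingUpperBoundAt W 3)
    (hodd : 0 ≤ padicValRat 3 W.j → ¬ (TypeGOrd W 3 ∧ semistabilityIndex W 3 = 2) →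
      (∃ q : ℚ, shaAn W = (q : ℂ) ∧ Odd (padicValRat 3 q)) → MissingUpperBoundAt W 3)
    (hmanin : 0 ≤ padicValRat 3 W.j → ¬ (TypeGOrd W 3 ∧ semistabilityIndex W 3 = 2) →
      (∀ (N : ℕ) [NeZero N] (D : ModularParametrizationData W N), (3 : ℤ) ∣ D.maninConstant) →
      MissingUpperBoundAt W 3) :
    MissingPPartAt W 3 ↔ MissingLowerBoundAt W 3 :=
  ⟨fun h ↦ (lower_and_upper_of_missingPPartAt W 3 h).1, fun h ↦
    missingPPartAt_of_lower_of_upper W 3 h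
      (X4RankZero.missingUpperBoundAt_three_of_residueInputs_typeG W hCT hKatoS hDel hGZK hmod hmodD hKatoχ
        hK hr hX hs hexotic htam hodd hmanin)⟩

/-- **Per pair at `3`: `BSD(E,3)` from the LOWER half, granted the residue inputs.**
[cite: Kato2004Asterisque, Thm. 14.5 (3) (p. 236)] [cite: Delbourgo1998, Prop. 4 (p. 144)]
[cite: Miller2011LMS, §1 and Def. 1.1] -/
theorem X4RankZero.bsdp_three_of_lower_of_residueInputs_typeG [Fact (Nat.Prime 3)]
    (hCT : exists_casselsTate_pairing (K := ℚ))
    (hKatoS : Kato2004.rankZero_padicValNat_sha_le_sub_localTamagawa_of_additive_potGood_of_imageContainsSL2)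
    (hDel : Delbourgo1998.prop4_rankZero_pow_dvd_constantCoeff)
    (hGZK : rank_eq_analyticRank_of_analyticRank_le_one) (hmod : hasEntireLFunction_rat)
    (hmodD : nonempty_modularParametrizationData)
    (hKatoχ : Wuthrich2014.kato_halfEigenCharIdeal_dvd_cyclotomicPrime_of_surjective)
    (hK : Kato2004.charIdeal_dvd_padicLFunctionBranch_component_of_surjective)
    (hr : W.analyticRank = 0) (hX : ClassX4 W 3) (hs : Surj W 3)
    (hexotic : 0 ≤ padicValRat 3 W.j → ¬ TypeG W 3 →
      ¬ (∀ n : ℕ, W.HasSurjectiveModNGaloisRep (3 ^ n : ℕ)) → MissingUpperBoundAt W 3)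
    (htam : 0 ≤ padicValRat 3 W.j → ¬ (TypeGOrd W 3 ∧ semistabilityIndex W 3 = 2) →
      padicValNat 3 ((W.baseChange ℚ_[3]).localTamagawaNumber ℤ_[3]) + 2 ≤
        padicValNat 3 W.tamagawaProduct → MissingUpperBoundAt W 3)
    (hodd : 0 ≤ padicValRat 3 W.j → ¬ (TypeGOrd W 3 ∧ semistabilityIndex W 3 = 2) →
      (∃ q : ℚ, shaAn W = (q : ℂ) ∧ Odd (padicValRat 3 q)) → MissingUpperBoundAt W 3)
    (hmanin : 0 ≤ padicValRat 3 W.j → ¬ (TypeGOrd W 3 ∧ semistabilityIndex W 3 = 2) →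
      (∀ (N : ℕ) [NeZero N] (D : ModularParametrizationData W N), (3 : ℤ) ∣ D.maninConstant) →
      MissingUpperBoundAt W 3)
    (hlow : MissingLowerBoundAt W 3) : BSDp W 3 :=
  bsdp_of_missingPPartAt W 3 hGZK (by rw [hr]; exact zero_le_one)
    ((X4RankZero.missingPPartAt_three_iff_lower_of_residueInputs_typeG W hCT hKatoS hDel hGZK hmod hmodD
      hKatoχ hK hr hX hs hexotic htam hodd hmanin).mpr hlow)

/-! ### §2 The NON-RESIDUE rows at `3` (binders of record): what remains is EXACTLY the LOWER half -/

/-- **The N11 corner, per pair: on a NON-RESIDUE row the UPPER half is a theorem.** `W` globally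
minimal, `r_an = 0`, `ClassX4 W 3`, `ρ̄_{E,3}` onto, and `W` on NO residue piece — that is:
`ord₃ j < 0` (potentially multiplicative), OR (G)-ordinary at `3` (then Kodaira `I₀*`, twist of a
good ordinary curve), OR [the `3`-adic tower is onto ∧ `ord₃ ∏ c_ℓ ≤ v₃(c₃) + 1` ∧ `#Ш_an = q` with
`ord₃ q` even ∧ some datum `D` with `3 ∤ c_D`] — ⟹ `MissingUpperBoundAt W 3`, from the eight
published inputs; no residue input, no certificate beyond the row's own bits.
[cite: Kato2004Asterisque, Thm. 14.5 (3) (p. 236), Thm. 17.4 (3) (p. 273)] [cite: Delbourgo1998, Prop. 4 (p. 144)]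
[cite: SilvermanAEC2009, Thm. X.4.14] [cite: Miller2011LMS, Def. 1.1] -/
theorem X4RankZero.missingUpperBoundAt_three_of_nonResidue_typeG [Fact (Nat.Prime 3)]
    (hCT : exists_casselsTate_pairing (K := ℚ))
    (hKatoS : Kato2004.rankZero_padicValNat_sha_le_sub_localTamagawa_of_additive_potGood_of_imageContainsSL2)
    (hDel : Delbourgo1998.prop4_rankZero_pow_dvd_constantCoeff)
    (hGZK : rank_eq_analyticRank_of_analyticRank_le_one) (hmod : hasEntireLFunction_rat)
    (hmodD : nonempty_modularParametrizationData)
    (hKatoχ : Wuthrich2014.kato_halfEigenCharIdeal_dvd_cyclotomicPrime_of_surjective)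
    (hK : Kato2004.charIdeal_dvd_padicLFunctionBranch_component_of_surjective)
    (hr : W.analyticRank = 0) (hX : ClassX4 W 3) (hs : Surj W 3)
    (hnon : padicValRat 3 W.j < 0 ∨ TypeGOrd W 3 ∨
      ((TypeG W 3 ∨ ∀ n : ℕ, W.HasSurjectiveModNGaloisRep (3 ^ n : ℕ)) ∧
        padicValNat 3 W.tamagawaProduct ≤
          padicValNat 3 ((W.baseChange ℚ_[3]).localTamagawaNumber ℤ_[3]) + 1 ∧
        (∃ q : ℚ, shaAn W = (q : ℂ) ∧ Even (padicValRat 3 q)) ∧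
        ∃ (N : ℕ) (_ : NeZero N) (D : ModularParametrizationData W N), ¬ (3 : ℤ) ∣ D.maninConstant)) :
    MissingUpperBoundAt W 3 := by
  rcases hnon with hj | hG | ⟨hTt, h1, ⟨q, hq, heven⟩, N, hN, D, hc⟩
  · exact AdditivePotMult.ClassX4M.missingUpperBoundAt_rankZero_of_surj_noL20 hDel hGZK hmod hmodD
      hKatoχ ⟨hX, hX.2.1, hj⟩ hr hs
  · exact ClassX4Gord.missingUpperBoundAt_three_of_katoComponent_of_surj hK hDel hGZK hmod hmodD
      ⟨hX, hG⟩ hr hs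
  · by_cases hj : padicValRat 3 W.j < 0
    · exact AdditivePotMult.ClassX4M.missingUpperBoundAt_rankZero_of_surj_noL20 hDel hGZK hmod hmodD
        hKatoχ ⟨hX, hX.2.1, hj⟩ hr hs
    · haveI := hN
      have htower : ∀ n : ℕ, W.HasSurjectiveModNGaloisRep (3 ^ n : ℕ) :=
        hTt.elim (fun hT ↦ TypeG.towerSurj_three_of_surj hT hX.2.1 hs) id
      exact X4RankZero.missingUpperBoundAt_of_katoSharp_of_casselsTate_of_tamDefect_le_one_of_even W 3
        hCT hKatoS hGZK hmod hr hX (not_lt.mp hj) htower D hc h1 hq heven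

/-- **THE N11 SENTENCE: on a non-residue row at `3`, what remains is EXACTLY the LOWER half** —
`MissingPPartAt W 3 ↔ MissingLowerBoundAt W 3`. [cite: Kato2004Asterisque, Thm. 14.5 (3) (p. 236)]
[cite: Delbourgo1998, Prop. 4 (p. 144)] [cite: Miller2011LMS, Def. 1.1] -/
theorem X4RankZero.missingPPartAt_three_iff_lower_of_nonResidue_typeG [Fact (Nat.Prime 3)]
    (hCT : exists_casselsTate_pairing (K := ℚ))
    (hKatoS : Kato2004.rankZero_padicValNat_sha_le_sub_localTamagawa_of_additive_potGood_of_imageContainsSL2)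
    (hDel : Delbourgo1998.prop4_rankZero_pow_dvd_constantCoeff)
    (hGZK : rank_eq_analyticRank_of_analyticRank_le_one) (hmod : hasEntireLFunction_rat)
    (hmodD : nonempty_modularParametrizationData)
    (hKatoχ : Wuthrich2014.kato_halfEigenCharIdeal_dvd_cyclotomicPrime_of_surjective)
    (hK : Kato2004.charIdeal_dvd_padicLFunctionBranch_component_of_surjective)
    (hr : W.analyticRank = 0) (hX : ClassX4 W 3) (hs : Surj W 3)
    (hnon : padicValRat 3 W.j < 0 ∨ TypeGOrd W 3 ∨
      ((TypeG W 3 ∨ ∀ n : ℕ, W.HasSurjectiveModNGaloisRep (3 ^ n : ℕ)) ∧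
        padicValNat 3 W.tamagawaProduct ≤
          padicValNat 3 ((W.baseChange ℚ_[3]).localTamagawaNumber ℤ_[3]) + 1 ∧
        (∃ q : ℚ, shaAn W = (q : ℂ) ∧ Even (padicValRat 3 q)) ∧
        ∃ (N : ℕ) (_ : NeZero N) (D : ModularParametrizationData W N), ¬ (3 : ℤ) ∣ D.maninConstant)) :
    MissingPPartAt W 3 ↔ MissingLowerBoundAt W 3 :=
  ⟨fun h ↦ (lower_and_upper_of_missingPPartAt W 3 h).1, fun h ↦
    missingPPartAt_of_lower_of_upper W 3 h
      (X4RankZero.missingUpperBoundAt_three_of_nonResidue_typeG W hCT hKatoS hDel hGZK hmod hmodD hKatoχ hK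
        hr hX hs hnon)⟩

/-- **`BSD(E,3)` on a non-residue N11 row from the LOWER half alone.**
[cite: Kato2004Asterisque, Thm. 14.5 (3) (p. 236)] [cite: Delbourgo1998, Prop. 4 (p. 144)]
[cite: Miller2011LMS, §1 and Def. 1.1] -/
theorem X4RankZero.bsdp_three_of_lower_of_nonResidue_typeG [Fact (Nat.Prime 3)]
    (hCT : exists_casselsTate_pairing (K := ℚ))
    (hKatoS : Kato2004.rankZero_padicValNat_sha_le_sub_localTamagawa_of_additive_potGood_of_imageContainsSL2)
    (hDel : Delbourgo1998.prop4_rankZero_pow_dvd_constantCoeff)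
    (hGZK : rank_eq_analyticRank_of_analyticRank_le_one) (hmod : hasEntireLFunction_rat)
    (hmodD : nonempty_modularParametrizationData)
    (hKatoχ : Wuthrich2014.kato_halfEigenCharIdeal_dvd_cyclotomicPrime_of_surjective)
    (hK : Kato2004.charIdeal_dvd_padicLFunctionBranch_component_of_surjective)
    (hr : W.analyticRank = 0) (hX : ClassX4 W 3) (hs : Surj W 3)
    (hnon : padicValRat 3 W.j < 0 ∨ TypeGOrd W 3 ∨
      ((TypeG W 3 ∨ ∀ n : ℕ, W.HasSurjectiveModNGaloisRep (3 ^ n : ℕ)) ∧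
        padicValNat 3 W.tamagawaProduct ≤
          padicValNat 3 ((W.baseChange ℚ_[3]).localTamagawaNumber ℤ_[3]) + 1 ∧
        (∃ q : ℚ, shaAn W = (q : ℂ) ∧ Even (padicValRat 3 q)) ∧
        ∃ (N : ℕ) (_ : NeZero N) (D : ModularParametrizationData W N), ¬ (3 : ℤ) ∣ D.maninConstant))
    (hlow : MissingLowerBoundAt W 3) : BSDp W 3 :=
  bsdp_of_missingPPartAt W 3 hGZK (by rw [hr]; exact zero_le_one)
    ((X4RankZero.missingPPartAt_three_iff_lower_of_nonResidue_typeG W hCT hKatoS hDel hGZK hmod hmodD hKatoχ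
      hK hr hX hs hnon).mpr hlow)

/-- **`BSD(E,3)` on a non-residue N11 row with `3 ∤ #Ш_an` — nothing else needed** (the unit block;
`ord₃ q = 0` is even, so the ODD-SHA bit is automatic). [cite: Kato2004Asterisque, Thm. 14.5 (3) (p. 236)]
[cite: Delbourgo1998, Prop. 4 (p. 144)] [cite: Miller2011LMS, §1 and Def. 1.1] -/
theorem X4RankZero.bsdp_three_of_nonResidue_of_shaAn_unit_typeG [Fact (Nat.Prime 3)]
    (hCT : exists_casselsTate_pairing (K := ℚ))
    (hKatoS : Kato2004.rankZero_padicValNat_sha_le_sub_localTamagawa_of_additive_potGood_of_imageContainsSL2)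
    (hDel : Delbourgo1998.prop4_rankZero_pow_dvd_constantCoeff)
    (hGZK : rank_eq_analyticRank_of_analyticRank_le_one) (hmod : hasEntireLFunction_rat)
    (hmodD : nonempty_modularParametrizationData)
    (hKatoχ : Wuthrich2014.kato_halfEigenCharIdeal_dvd_cyclotomicPrime_of_surjective)
    (hK : Kato2004.charIdeal_dvd_padicLFunctionBranch_component_of_surjective)
    (hr : W.analyticRank = 0) (hX : ClassX4 W 3) (hs : Surj W 3)
    {q : ℚ} (hq : shaAn W = (q : ℂ)) (hv : padicValRat 3 q = 0)
    (hnon : padicValRat 3 W.j < 0 ∨ TypeGOrd W 3 ∨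
      ((TypeG W 3 ∨ ∀ n : ℕ, W.HasSurjectiveModNGaloisRep (3 ^ n : ℕ)) ∧
        padicValNat 3 W.tamagawaProduct ≤
          padicValNat 3 ((W.baseChange ℚ_[3]).localTamagawaNumber ℤ_[3]) + 1 ∧
        ∃ (N : ℕ) (_ : NeZero N) (D : ModularParametrizationData W N), ¬ (3 : ℤ) ∣ D.maninConstant)) :
    BSDp W 3 :=
  bsdp_of_missingPPartAt W 3 hGZK (by rw [hr]; exact zero_le_one)
    (missingPPartAt_of_upper_of_shaAn_unit W 3
      (X4RankZero.missingUpperBoundAt_three_of_nonResidue_typeG W hCT hKatoS hDel hGZK hmod hmodD hKatoχ hK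
        hr hX hs (hnon.imp_right (Or.imp_right fun ⟨ht, h1, hD⟩ ↦
          ⟨ht, h1, ⟨q, hq, by rw [hv]; exact ⟨0, by norm_num⟩⟩, hD⟩)))
      hq hv)

/-! ### §3 The class-level equivalence at `3` (binders of record) -/

/-- **X4♯(unit-free) AT `p = 3` ⟺ LOWER₃ ∧ EXOTIC♭₃ ∧ TAM-DEFECT₂♭₃ ∧ ODD-SHA♭₃ ∧ MANIN♭₃** — the
`p = 3` restriction of additive-p4's end-state `x4SharpUnitFree_iff_lower_and_residues_sharp` (in
n1011-p14's exotic-flat form), with the (M)@3 chain's Wuthrich-Lemma-20 binder replaced by the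
certificate-free tower. Left side: every X4 ∧ `r_an = 0` ∧ surj(3) curve satisfies Miller's
`MissingPPartAt W 3`; right side: the LOWER half on all of them, and the UPPER half on each of the
four residue pieces (all restricted to `ord₃ j ≥ 0` and not (G-ord, `e = 2`)).
[cite: Kato2004Asterisque, Thm. 14.5 (3) (p. 236), Thm. 17.4 (3) (p. 273)] [cite: Delbourgo1998, Prop. 4 (p. 144)]
[cite: SilvermanAEC2009, Thm. X.4.14] [cite: Kim2022StructureSelmer, Conj. 1.10 (PDF p. 8)]
[cite: Miller2011LMS, Def. 1.1] -/
theorem x4SharpThreeUnitFree_iff_lower_and_residues_exoticTypeG [Fact (Nat.Prime 3)]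
    (hCT : exists_casselsTate_pairing (K := ℚ))
    (hKatoS : Kato2004.rankZero_padicValNat_sha_le_sub_localTamagawa_of_additive_potGood_of_imageContainsSL2)
    (hDel : Delbourgo1998.prop4_rankZero_pow_dvd_constantCoeff)
    (hGZK : rank_eq_analyticRank_of_analyticRank_le_one) (hmod : hasEntireLFunction_rat)
    (hmodD : nonempty_modularParametrizationData)
    (hKatoχ : Wuthrich2014.kato_halfEigenCharIdeal_dvd_cyclotomicPrime_of_surjective)
    (hK : Kato2004.charIdeal_dvd_padicLFunctionBranch_component_of_surjective) :
    (∀ (W : WeierstrassCurve ℚ) [W.IsElliptic] [W.IsGloballyMinimal],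
        W.analyticRank = 0 → ClassX4 W 3 → Surj W 3 → MissingPPartAt W 3) ↔
      (∀ (W : WeierstrassCurve ℚ) [W.IsElliptic] [W.IsGloballyMinimal],
          W.analyticRank = 0 → ClassX4 W 3 → Surj W 3 → MissingLowerBoundAt W 3) ∧
      (∀ (W : WeierstrassCurve ℚ) [W.IsElliptic] [W.IsGloballyMinimal],
          W.analyticRank = 0 → ClassX4 W 3 → Surj W 3 → 0 ≤ padicValRat 3 W.j → ¬ TypeG W 3 →
          ¬ (∀ n : ℕ, W.HasSurjectiveModNGaloisRep (3 ^ n : ℕ)) → MissingUpperBoundAt W 3) ∧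
      (∀ (W : WeierstrassCurve ℚ) [W.IsElliptic] [W.IsGloballyMinimal],
          W.analyticRank = 0 → ClassX4 W 3 → Surj W 3 → 0 ≤ padicValRat 3 W.j →
          ¬ (TypeGOrd W 3 ∧ semistabilityIndex W 3 = 2) →
          padicValNat 3 ((W.baseChange ℚ_[3]).localTamagawaNumber ℤ_[3]) + 2 ≤
            padicValNat 3 W.tamagawaProduct → MissingUpperBoundAt W 3) ∧
      (∀ (W : WeierstrassCurve ℚ) [W.IsElliptic] [W.IsGloballyMinimal],
          W.analyticRank = 0 → ClassX4 W 3 → Surj W 3 → 0 ≤ padicValRat 3 W.j →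
          ¬ (TypeGOrd W 3 ∧ semistabilityIndex W 3 = 2) →
          (∃ q : ℚ, shaAn W = (q : ℂ) ∧ Odd (padicValRat 3 q)) → MissingUpperBoundAt W 3) ∧
      (∀ (W : WeierstrassCurve ℚ) [W.IsElliptic] [W.IsGloballyMinimal],
          W.analyticRank = 0 → ClassX4 W 3 → Surj W 3 → 0 ≤ padicValRat 3 W.j →
          ¬ (TypeGOrd W 3 ∧ semistabilityIndex W 3 = 2) →
          (∀ (N : ℕ) [NeZero N] (D : ModularParametrizationData W N), (3 : ℤ) ∣ D.maninConstant) →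
          MissingUpperBoundAt W 3) := by
  constructor
  · intro h
    refine ⟨fun V _ _ hr hX hs ↦ (lower_and_upper_of_missingPPartAt V 3 (h V hr hX hs)).1,
      fun V _ _ hr hX hs _ _ _ ↦ (lower_and_upper_of_missingPPartAt V 3 (h V hr hX hs)).2,
      fun V _ _ hr hX hs _ _ _ ↦ (lower_and_upper_of_missingPPartAt V 3 (h V hr hX hs)).2,
      fun V _ _ hr hX hs _ _ _ ↦ (lower_and_upper_of_missingPPartAt V 3 (h V hr hX hs)).2,
      fun V _ _ hr hX hs _ _ _ ↦ (lower_and_upper_of_missingPPartAt V 3 (h V hr hX hs)).2⟩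
  · rintro ⟨hlow, hexotic, htam, hodd, hmanin⟩ V _ _ hr hX hs
    exact (X4RankZero.missingPPartAt_three_iff_lower_of_residueInputs_typeG V hCT hKatoS hDel hGZK hmod hmodD
      hKatoχ hK hr hX hs (hexotic V hr hX hs) (htam V hr hX hs) (hodd V hr hX hs)
      (hmanin V hr hX hs)).mpr (hlow V hr hX hs)

end Summit.BirchSwinnertonDyer.Rank1Residual.Additive

end
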